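import Literature.AlgebraicGeometry.Hironaka2017.S05NegativePart.R008aPNegaCarrier
import Literature.AlgebraicGeometry.Hironaka2017.S07Permissible.R013PNegaTransform
import Mathlib.LinearAlgebra.Quotient.Basic
import HarnessLib

/-!
# [OURS · L1 W1.1] Graded reading of `℘nega`: the literal associated-graded piece, and the transform-law schema
# «Eq. (59) with the negative-module constructor as a parameter» (v1: objects + claim schema)

LADDER-RESOLUTION rung L (rescue), cell `res-hironaka` (run/shared/lean/pub/res-hironaka/), slot **W1.1** of
plan/RESCUE-SEED.md §1 L-G1 («GRADED READING: replace `℘̃(E,−a)` by the associated-graded piece of the ℘-filtration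
(Rem 9.25 p.58 «degrees ignored» vs §16's graded use) … re-run R04's Eq. (59) … with it»). AUTHORITY for file name,
host item and typer: plan/SIZED-ASK-L.md §4 paragraph S-s11/S-s12/S-s13 (res-plan-2): «`Theorems/MarkedTransferCampaign
W11PnegaGr.lean` (def `Campaign.PnegaGr` + Prop `CampaignW11GradedTransformLaw` = the graded analogue of Th 7.8 (59)
under permissible blow-up) … HOST: MarkedTransfer `--supports stmt-ResolutionOfSingularities-15522` … TYPER / LANES:
type-o2». OURS objects, SUMMIT-SIDE (director-resolution 2026-08-26T15:23:05Z), statement-only lane, typer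
res-L1-type-o2.

WHAT v1 TYPES AND WHAT IT LEAVES OPEN. The slot's `Campaign.PnegaGr` has, at typing time, exactly ONE precise reading
on record: kill test K1.1's pre-registration (res-L1-k11, HOME/L/res-L1-k11/PREREG-K1.1.md, STATUS 2026-08-26T18:49:23Z)
— «the ASSOCIATED GRADED of the ℤ-filtration `i ↦ ℘̃(E,i)` of `O_Z` …: for `a ≥ 1`, `PnegaGr(E,−a) := ℘̃(E,−a) /
℘̃(E,−(a−1))` (quotient `O`-module) … `PnegaGr K P m a := Submodule.map (Submodule.mkQ (pTildeNeg K P m ((a:ℤ)−1)))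
(pNega K P m a)`». That reading is typed here VERBATIM as `Campaign.pnegaGrLit` (so K1.1 and the s11 campaign can share
one decl); K1.1 itself registers the expectation that this literal reading is degenerate on its witness, and
res-L1-s11-plan-1 (WAKE-gated, not seated at typing time) may define a DIFFERENT `Campaign.PnegaGr` — which will be
APPENDED to this file as a sibling decl, never substituted. Independently of which negative-module constructor the
campaign adopts, the shape of its first statement is fixed by the slot («the graded analogue of Th 7.8 (59)»): this
file therefore types the TRANSFORM-LAW SCHEMA `Campaign.TransformLaw59With N …` = row 013's `S07Permissible.Eq59`
(p.37 L8–L13) with the constructor `℘nega(·,−a)` ↦ `N` abstracted into a parameter, and records by `rfl`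
(`transformLaw59With_pNegaSheaf`) that at `N := S05NegativePart.pNegaSheaf` it IS the typed Eq. (59). The campaign
statement `CampaignW11GradedTransformLaw` = `TransformLaw59With <the campaign's PnegaGr as an ideal-sheaf constructor>`
on its instance class is res-L1-s11-plan-1's rank-9 item and is NOT in this file.

HONEST FRAMING. Nothing in this file is a statement of H. Hironaka's manuscript *Resolution of singularities in
positive characteristics* (2017-03-23, [Hironaka2017], lit key `paper:url-3343fd9e678b`), nothing here asserts or
denies any statement of it, and nothing here is progress on resolution of singularities in positive characteristic.
Def 5.1 (p.25 L29–L38, Eq. (36)) is TYPED — not asserted — by PARTITION row 008 (`S05NegativePart.{DD, pTildeNeg,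
pNega}`, ring level); Th 7.8 / Eq. (59) (p.37 L3–L17) by row 013 (`S07Permissible.{Thm7_8, Eq59, lsbExcPow,
Thm7_8Setting}`, sheaf level). Rem 9.25 (p.58 L8–L16: «Those degrees are ignored and the terms of H(e) are summed up as
if they are elements of O(V) … However whenever we come to talk about any permissible blowups we must go back to the
original homogeneity summands and honor their inherited rule of transformations») is quoted for scope only. No barrier
of `Literature/Barriers/ResolutionOfSingularities/` addresses the ℘-calculus («technique class outside the catalogue»,
SIZED-ASK-L l.154). AI transcription/typing is weaker than expert review.

## Contents (definitions + one `rfl` anchor; no claim about the manuscript)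
* `Campaign.pnegaGrLit` — K1.1's literal associated-graded piece `℘̃(E,−a)/℘̃(E,−(a−1))`, ring level over row 008.
* `Campaign.NegModuleConstructor` — the TYPE of a sheaf-level negative-module constructor `(f, E, m, a) ↦ ideal sheaf`
  (row 008's `pNegaSheaf` has this type).
* `Campaign.TransformLaw59With` — Eq. (59) at one point `ξ′` with the constructor as a parameter (schema; stated, not
  claimed); `Campaign.transformLaw59With_pNegaSheaf` — at `pNegaSheaf` it is `S07Permissible.Eq59` (`Iff.rfl`).
-/

noncomputable section

set_option linter.dupNamespace false -- mandated namespace of this single-conjunct summit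

namespace Summit.ResolutionOfSingularities.ResolutionOfSingularities.Theorems.Campaign

open _root_.CategoryTheory _root_.AlgebraicGeometry
open Literature.AlgebraicGeometry.Resolution
open Literature.AlgebraicGeometry.Hironaka2017
open Literature.AlgebraicGeometry.Hironaka2017.S02Preliminaries (IdealExponent LSB)

universe u v

/-! ## K1.1's literal associated-graded reading (ring level) -/

section RingLevel

variable (K : Type u) {A : Type v} [CommRing K] [CommRing A] [Algebra K A]

/-- [OURS · L1 W1.1, reading «gr of the `℘̃`-filtration», verbatim from K1.1's PREREG] replaces the role of Def 5.1's
`℘nega(E,−a)`, `a ≥ 1` (p.25 L37–L38) by the ASSOCIATED-GRADED PIECE `℘̃(E,−a) / ℘̃(E,−(a−1))` of the `ℤ`-filtration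
`i ↦ ℘̃(E,i)` (the image of row 008's `pNega K P m a` in the quotient `A ⧸ pTildeNeg K P m (a−1)`, exactly
res-L1-k11's `PnegaGr`); NOT a statement of the manuscript. Parameters as in row 008: base ring `K`, `P j = ℘(E,j)`
(I-P row 003), Def 5.1's `m`, and `a : ℕ` (intended `a ≥ 1`; at `a = 0` the modulus is
`pTildeNeg K P m (−1) = ℘̃(E,1)` — Def 5.1 is stated «for every integer `a ∈ ℤ`», p.25 L33–L34 — so the value is the
degree-`0` graded piece `℘̃(E,0)/℘̃(E,1)`, as K1.1's PREREG also records; docstring corrected in v2 after lane A's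
content note, res-L1-ref-a2 2026-08-26T19:07:23Z). VACUITY: `= ⊥` exactly when `℘̃(E,−a) ⊆ ℘̃(E,−(a−1))` —
which is what K1.1 registers to decide on its witness; not settled here. [folklore] -/
def pnegaGrLit (P : ℕ → Ideal A) (m a : ℕ) :
    Submodule A (A ⧸ S05NegativePart.pTildeNeg K P m ((a : ℤ) - 1)) :=
  Submodule.map (Submodule.mkQ (S05NegativePart.pTildeNeg K P m ((a : ℤ) - 1))) (S05NegativePart.pNega K P m a)

end RingLevel

/-! ## The transform-law schema: Eq. (59) with the negative-module constructor abstracted -/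

section SheafLevel

variable {K : Type u} [Field K]

/-- The TYPE of a sheaf-level negative-module constructor: to a structure morphism `f : Z → Spec K`, an ideal
exponent `E` on `Z`, Def 5.1's integer `m` and a degree index `a` it assigns an ideal sheaf on `Z` («the module in
degree `−a`»). Row 008's `S05NegativePart.pNegaSheaf` has this type; a campaign constructor (graded, sandwich, …)
rendered as ideal sheaves would too. Plumbing, OURS. [folklore] -/
abbrev NegModuleConstructor (K : Type u) [Field K] : Type (u + 1) :=
  ∀ ⦃Z : Scheme.{u}⦄, (Z ⟶ Spec (.of K)) → IdealExponent Z → ℕ → ℕ → Z.IdealSheafData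

/-- [OURS · L1 W1.1] SCHEMA replacing the role of Th 7.8 Eq. (59) (p.37 L8–L13: «`℘nega(E′,−a)_{ξ′} =
(∏_i I(D_i,Z_i)^a)(℘nega(E,−a)O_{Z′})_{ξ′}`») for an ARBITRARY negative-module constructor `N` in place of
`℘nega(·,−a)`: at ONE point `ξ′` of the top `Z′` of the LSB `L` over `Z`, the stalk of `N` of the transform
`E′ = L.transform E` (structure morphism `L.comp ≫ f`) equals the stalk of `(∏_i I(D_i,Z_i)^a) · (N(E) O_{Z′})`
(row 013's `S07Permissible.lsbExcPow L a` times the inverse image of `N f E m a` along `π = L.comp`) — literally row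
013's `Eq59` with `pNegaSheaf` replaced by `N`. The slot's «graded transform law» `CampaignW11GradedTransformLaw` is
this schema at the campaign's constructor, on its instance class — res-L1-s11-plan-1's item, NOT asserted here; K1.1
evaluates it on the R04 witness. VACUITY: degenerate instances exist by design of a schema — at `a = 0` the
exceptional factor `lsbExcPow L 0` is `⊤`, and a constant constructor (e.g. `N ≡ ⊤`) makes both sides agree up to
pull-back bookkeeping; the campaign item, not this schema, names a non-degenerate `N` and `a ≥ 1`. [folklore] -/
def TransformLaw59With (N : NegModuleConstructor K) {Z : Scheme.{u}} (f : Z ⟶ Spec (.of K)) (E : IdealExponent Z)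
    (m : ℕ) (L : LSB Z) (ξ' : L.top) (a : ℕ) : Prop :=
  stalkIdeal (N (L.comp ≫ f) (L.transform E) m a) ξ' =
    stalkIdeal (S07Permissible.lsbExcPow L a * (N f E m a).comap L.comp) ξ'

/-- Anchor (by `Iff.rfl`): at the printed constructor `N := S05NegativePart.pNegaSheaf` (row 008, Def 5.1 as ideal
sheaves) the schema IS the typed Eq. (59) of row 013, `S07Permissible.Eq59 f E m L ξ' a`. [folklore] -/
theorem transformLaw59With_pNegaSheaf {Z : Scheme.{u}} (f : Z ⟶ Spec (.of K)) (E : IdealExponent Z) (m : ℕ)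
    (L : LSB Z) (ξ' : L.top) (a : ℕ) :
    TransformLaw59With (fun _ f E m a => S05NegativePart.pNegaSheaf f E m a) f E m L ξ' a ↔
      S07Permissible.Eq59 f E m L ξ' a :=
  Iff.rfl

end SheafLevel

end Summit.ResolutionOfSingularities.ResolutionOfSingularities.Theorems.Campaign
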